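import Summits.QuantumFields.BalabanUV.T4Continuum.Support.CovariantVectorGreenDecayChart

/-!
# T⁴ programme, SUBSTRATE (shared lattice-gauge analysis library) — COMBES–THOMAS DECAY ON THE COMPLEX CHART BALL, II: THE EXPLICIT LEVEL-FREE
# RATE `κ_F(|o|, d, a′, γ)` and **`‖G(e^{A}R⁰, (R⁰)⁻¹e^{−A})(i, i′)‖ ≤ (8/γ)·e^{−κ_F·dist_∞(x, x′)/n}`** for `‖A‖ < rho1 (∋ rhoStar/n)`, with the
# tower corollary on `InHoloBallT P R⁰ (rhoStar/lev k)` (typer LIBRARY-v0.1 item W-9 ∕ L-A7, file 4 of 4; consumers NE5 Road D ∕ NE4 ∕ NE9 A3-HOL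
# read print's «(1.5) on 𝐔^c» at complex chart points — here PROVED on the substrate's ball)

Substrate cell `b2b-balaban-substrate-*`, seat p3 (gen 2).  From file 3's `greenT_chart_entry_decay` (any rate `κ` with `JchT(κ) < γ/4`):
 * §4 `Lst d = 2(d+1)`, **`B0 co d a′ L = 2co·d + 9a′co²L²e^{L²/2}`**, **`kappaF co d a′ γ = min (min 1 (γ/(24·B0 + 1))) (min (√γ/(40√d + 1))
   (1/(3·Le^L(2 + Le^L) + 1)))`**, `L = Lst d` — depends on `(|o|, d, a′, γ)` ONLY; `kappaF_pos_le_one`;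
   **`Jch_kappaF_le`**: inside `rho1` (`0 ≤ t < rho1 n d a′ co ℓ γ`, `1 ≤ co`, `1 ≤ n`) each of the three budgets at `κ_F` is `≤ γ/24`
   (real slice: `J0u ≤ B0·κ`; Laplacian: `n²(e^{κ/n} − 1) ≤ 3nκ`, `δ ≤ 3t`, `√d·n·t ≤ √γ/24`, `√d·κ ≤ √γ/40` ⇒ `Jlap ≤ 63γ/1920`; averaging:
   `θ_L ≤ κLe^L`, `E ≤ 6ℓt ≤ 2`, `384a′co²ℓt ≤ γ` ⇒ `Javg ≤ (γ/8)·Le^L(2+Le^L)·κ ≤ γ/24`), so `JchT(κ_F) ≤ γ/8`;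
   **`greenT_chart_entry_decay_explicit`**: `‖G(e^{A}R⁰, (R⁰)⁻¹e^{−A})(i, i′)‖ ≤ (8/γ)·e^{−κ_F·dist_∞(x,x′)/n}`;
 * §5 **`greenT_chart_entry_decay_tower`**: at NE2 level `k` (letters `c = lev k`, `a = a′(lev k)^d`, contours of length `≤ ℓ ≤ (d+1)·lev k`), on
   `InHoloBallT P R⁰ (rhoStar γ d a′ |o| / lev k)` (HoloForm's `rhoStar_div_le_rho1` BY NAME): decay at rate `κ_F/lev k`, amplitude `8/γ`.
TRUE FORM vs the typed W-9 (MAP §4 PROTOCOL): amplitude `8/γ`, not `4/γ` — the conjugation budget is paid out of the chart ball's `γ/4`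
(`JchT ≤ γ/8 ⇒ γ_w = γ/8`); `4/γ` is the `κ = 0` bound `opNorm_greenT_le_of_norm_lt_rho1` already landed.
HONEST FRAMING (T4-DAG p. 1).  MODEL-level finite-dimensional linear algebra ([folklore]; constants OURS and crude); no estimate of any NE row;
nothing printed is a hypothesis ([Balaban1988RG2Cluster] (1.5) p. 3 is a KIND pointer only); the `def`s are explicit real constants (no
`def … : Prop`); spine 0/9 unchanged; NOT infinite volume ∕ mass gap ∕ Clay.  HONEST DEPENDENCY: continuum YM on T⁴ ⇐ BetaPertH ∧ nine spine
estimates (0/9 proved); BetaPertH ⇐ (D1) ∧ (D4) ∧ CAP+tail; G-an2-4 gates asym, D1 and NE2/3/4.  ABSOLUTE RULE kept; no `sorry`.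
-/

noncomputable section

open scoped BigOperators ComplexConjugate Matrix Matrix.Norms.L2Operator Kronecker ComplexOrder

namespace Summit.QuantumFields.BalabanUV.T4Continuum.CovariantVectorGreenDecayChartExplicit

open Literature.MathematicalPhysics.QuantumFieldTheory.Balaban1983to89.B5Prop11Plancherel (Tor fine unitVec shiftM)
open Literature.MathematicalPhysics.QuantumFieldTheory.Balaban1983to89.B5Prop11Lower (nsq nsq_nonneg)
open Literature.MathematicalPhysics.QuantumFieldTheory.Balaban1983to89.B5Block118 (bpt tstep)
open Literature.MathematicalPhysics.QuantumFieldTheory.Balaban1983to89.Beta.DeltaACombesThomas (ctRowDefect ctRowDefect_add_le ctRowDefect_smul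
  ctRowDefect_sub_le qr qr_ne_zero sq_mul_cosh_div_sub_one_le)
open Literature.MathematicalPhysics.QuantumFieldTheory.Balaban1983to89.Beta.DeltaACombesThomasSets (rhoT rhoT_lipschitz rhoT_le_zero_of_mem le_rhoT
  stencil_osc_of_lipschitz)
open Literature.MathematicalPhysics.QuantumFieldTheory.Balaban1983to89.Beta.TorusG0Decay (ldist)
open Summit.QuantumFields.BalabanUV.T4Continuum
open Summit.QuantumFields.BalabanUV.Beta.AccretiveCombesThomas (nsq_single)
open Summit.QuantumFields.BalabanUV.T4Continuum.BlockMultiplication (siteMul)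
open Summit.QuantumFields.BalabanUV.T4Continuum.AbelianCovariantLaplacian (tauInv)
open Summit.QuantumFields.BalabanUV.T4Continuum.ColourCovariantLaplacian (covDc covLapC)
open Summit.QuantumFields.BalabanUV.T4Continuum.CovariantBlockAveraging (transport ContourSystem Qcov)
open Summit.QuantumFields.BalabanUV.T4Continuum.CoerciveInverseTower (Coercive)
open Summit.QuantumFields.BalabanUV.T4Continuum.SubstrateTransporterSpecies
open Summit.QuantumFields.BalabanUV.T4Continuum.CovariantVectorCoercive (vecOp vecOp_isHermitian)
open Summit.QuantumFields.BalabanUV.T4Continuum.CovariantVectorCTDefects (rhoV ctRowDefect_siteMul_eq_zero ctRowDefect_one_eq_zero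
  ctRowDefect_siteMul_kronShiftM_le ctRowDefect_siteMul_kronShiftM_adj_le ctRowDefect_finset_sum_le covDc_sq_eq ctRowDefect_mass_le)
open Summit.QuantumFields.BalabanUV.T4Continuum.CovariantVectorGreenDecay (cosh_mul_sub_one_le_linear sq_mul_exp_le_two_mul)
open Summit.QuantumFields.BalabanUV.T4Continuum.CovariantVectorCoerciveHolo (deltaQT_adjOf_eq_vecOp InHoloBallT inHoloBallT_apply)
open Summit.QuantumFields.BalabanUV.T4Continuum.CovariantVectorChartModulus (norm_of_unitary)
open Summit.QuantumFields.BalabanUV.T4Continuum.CovariantVectorChartFactorisation (Etr Etr_nonneg)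
open Summit.QuantumFields.BalabanUV.T4Continuum.CovariantVectorCoerciveHoloForm (rho1 rho1_pos coercive_deltaQT_of_norm_lt_rho1 rhoStar rhoStar_pos
  rhoStar_div_le_rho1)
open Summit.QuantumFields.BalabanUV.T4Continuum.CTWeightedCoercivity (ConjDefect ConjDefect.add conjDefect_of_rowDefect WCoercive wCoercive_of_coercive)
open Summit.QuantumFields.BalabanUV.T4Continuum.CovariantVectorChartConjugation (conjDefect_covLapT_chart)
open Summit.QuantumFields.BalabanUV.T4Continuum.CovariantVectorChartConjugationAvg (norm_transport_sub_one_le_two conjDefect_avg_chart)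
open Summit.QuantumFields.BalabanUV.T4Continuum.CovariantVectorGreenDecayChart

variable {d : ℕ} {o : Type*} [Fintype o] [DecidableEq o] [Nonempty o]

/-! ## §4 The explicit level-free rate -/

section Rate

/-- the standard stencil oscillation `Lst d = 2(d+1)` of the distance-to-the-source weight. [folklore] -/
abbrev Lst (d : ℕ) : ℝ := 2 * ((d : ℝ) + 1)

/-- **the linear real-slice constant** `B0 co d a′ L = 2co·d + 9a′co²·L²e^{L²/2}` (`J0u κ ≤ B0·κ` on `[0,1]`). [folklore] -/
def B0 (co d : ℕ) (a' L : ℝ) : ℝ := 2 * co * d + 9 * a' * (co : ℝ) ^ 2 * (L ^ 2 * Real.exp (L ^ 2 / 2))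

/-- **THE EXPLICIT RATE** `kappaF co d a′ γ = min (min 1 (γ/(24·B0 + 1))) (min (√γ/(40√d + 1)) (1/(3·Le^L·(2 + Le^L) + 1)))`, `L = 2(d+1)` —
depends on `(|o|, d, a′, γ)` only. [folklore] -/
def kappaF (co d : ℕ) (a' γ : ℝ) : ℝ :=
  min (min 1 (γ / (24 * B0 co d a' (Lst d) + 1)))
    (min (Real.sqrt γ / (40 * Real.sqrt d + 1)) (1 / (3 * (Lst d * Real.exp (Lst d) * (2 + Lst d * Real.exp (Lst d))) + 1)))

omit [Fintype o] [DecidableEq o] [Nonempty o] in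
/-- `B0 ≥ 0`. [folklore] -/
theorem B0_nonneg (co d : ℕ) {a' : ℝ} (ha' : 0 ≤ a') (L : ℝ) : 0 ≤ B0 co d a' L := by unfold B0; positivity

omit [Fintype o] [DecidableEq o] [Nonempty o] in
/-- `0 < kappaF ≤ 1` for `γ > 0`, `a′ ≥ 0`. [folklore] -/
theorem kappaF_pos_le_one (co d : ℕ) {a' γ : ℝ} (ha' : 0 ≤ a') (hγ : 0 < γ) : 0 < kappaF co d a' γ ∧ kappaF co d a' γ ≤ 1 := by
  have hB := B0_nonneg co d ha' (Lst d)
  have hL : 0 ≤ Lst d := by unfold Lst; positivity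
  refine ⟨?_, (min_le_left _ _).trans (min_le_left _ _)⟩
  unfold kappaF
  exact lt_min (lt_min zero_lt_one (by positivity)) (lt_min (by positivity) (by positivity))

omit [Fintype o] [DecidableEq o] [Nonempty o] in
/-- **THE RATE IS ADMISSIBLE**: inside `rho1` (`0 ≤ t < rho1 n d a′ co ℓ γ`, `1 ≤ co`, `1 ≤ n`, `ℓ ≤ (d+1)n`) the total budget at `κ_F` is at most
`γ/8` — each of the three parts at most `γ/24`. [folklore] -/
theorem Jch_kappaF_le {a' γ t : ℝ} (ha' : 0 ≤ a') (hγ : 0 < γ) {co n : ℕ} (hco : 1 ≤ co) (hn : 1 ≤ n) (d ℓ : ℕ)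
    (ht0 : 0 ≤ t) (ht : t < rho1 n d a' co ℓ γ) :
    JchT co d n ℓ a' (kappaF co d a' γ) t ≤ γ / 8 := by
  -- `e^x − 1 ≤ x·e^x` (convexity; = `Literature.Analysis.ODE.exp_sub_one_le_mul_exp`, re-derived inline to keep the import cone)
  have exp_sub_one_le_mul_exp : ∀ x : ℝ, Real.exp x - 1 ≤ x * Real.exp x := fun x => by
    have h := Real.add_one_le_exp (-x)
    have hprod : Real.exp x * Real.exp (-x) = 1 := by rw [← Real.exp_add, add_neg_cancel, Real.exp_zero]
    nlinarith [Real.exp_pos x, Real.exp_pos (-x)]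
  set κ := kappaF co d a' γ with hκdef
  set L := Lst d with hLdef
  have hL0 : 0 ≤ L := by rw [hLdef]; unfold Lst; positivity
  obtain ⟨hκ0', hκ1⟩ := kappaF_pos_le_one co d ha' hγ
  have hκ0 : 0 ≤ κ := hκ0'.le
  have habs : |κ| = κ := abs_of_nonneg hκ0
  have hB := B0_nonneg co d ha' L
  have hκB : κ ≤ γ / (24 * B0 co d a' L + 1) := (min_le_left _ _).trans (min_le_right _ _)
  have hκd : κ ≤ Real.sqrt γ / (40 * Real.sqrt d + 1) := (min_le_right _ _).trans (min_le_left _ _)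
  have hκP : κ ≤ 1 / (3 * (L * Real.exp L * (2 + L * Real.exp L)) + 1) := (min_le_right _ _).trans (min_le_right _ _)
  have hℓ : (0 : ℝ) ≤ ℓ := Nat.cast_nonneg _
  have hco1 : (1 : ℝ) ≤ co := by exact_mod_cast hco
  have hd0 : (0 : ℝ) ≤ d := Nat.cast_nonneg _
  have hn1 : (1 : ℝ) ≤ n := by exact_mod_cast hn
  have hn0 : (0 : ℝ) < n := by linarith
  -- the radius letters
  have ht4 : t ≤ 1 / 4 := ht.le.trans ((min_le_left _ _).trans (min_le_left _ _))
  have ht1 : t ≤ 1 / (3 * (ℓ : ℝ) + 1) := ht.le.trans ((min_le_left _ _).trans (min_le_right _ _))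
  have ht2 : t ≤ Real.sqrt γ / (24 * Real.sqrt d * n + 1) := ht.le.trans ((min_le_right _ _).trans (min_le_left _ _))
  have ht3 : t ≤ γ / (384 * a' * (co : ℝ) ^ 2 * ℓ + 1) := ht.le.trans ((min_le_right _ _).trans (min_le_right _ _))
  have he : Real.exp t ≤ 3 := (Real.exp_le_exp.mpr (by linarith : t ≤ 1)).trans (by have := Real.exp_one_lt_d9; norm_num at this ⊢; linarith)
  set δ := t * Real.exp t with hδdef
  have hδ0 : 0 ≤ δ := by positivity
  have hδ3 : δ ≤ 3 * t := by rw [hδdef, mul_comm]; exact mul_le_mul_of_nonneg_right he ht0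
  have hδ34 : δ ≤ 3 / 4 := by linarith
  -- (1) the real slice: `J0u ≤ B0·κ ≤ γ/24`
  have h1 : J0u co d a' κ L ≤ γ / 24 := by
    have hlin : J0u co d a' κ L ≤ B0 co d a' L * κ := by
      rw [J0u, B0, add_mul]
      refine add_le_add ?_ ?_
      · have h := sq_mul_exp_le_two_mul hκ0 hκ1
        calc (co : ℝ) * d * (κ ^ 2 * Real.exp (κ ^ 2 / 2)) ≤ co * d * (2 * κ) := mul_le_mul_of_nonneg_left h (by positivity)
          _ = 2 * co * d * κ := by ring
      · have h := cosh_mul_sub_one_le_linear (L := L) hκ0 hκ1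
        calc 9 * a' * (co : ℝ) ^ 2 * (Real.cosh (κ * L) - 1) ≤ 9 * a' * (co : ℝ) ^ 2 * (κ * (L ^ 2 * Real.exp (L ^ 2 / 2))) :=
              mul_le_mul_of_nonneg_left h (by positivity)
          _ = 9 * a' * (co : ℝ) ^ 2 * (L ^ 2 * Real.exp (L ^ 2 / 2)) * κ := by ring
    have hden : 0 < 24 * B0 co d a' L + 1 := by positivity
    have h2 : B0 co d a' L * κ ≤ γ / 24 := by
      calc B0 co d a' L * κ ≤ B0 co d a' L * (γ / (24 * B0 co d a' L + 1)) := mul_le_mul_of_nonneg_left hκB hB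
        _ = γ / 24 * (24 * B0 co d a' L / (24 * B0 co d a' L + 1)) := by field_simp
        _ ≤ γ / 24 * 1 := mul_le_mul_of_nonneg_left ((div_le_one hden).mpr (by linarith)) (by positivity)
        _ = γ / 24 := mul_one _
    exact hlin.trans h2
  -- (2) the Laplacian perturbation: `Jlap ≤ (63/2)·d·n·κ·t ≤ 63γ/1920`
  have h2 : Jlap d n κ t ≤ γ / 24 := by
    have hexp1 : (n : ℝ) ^ 2 * (Real.exp (|κ| * (1 / n)) - 1) ≤ 3 * n * κ := by
      rw [habs]
      have hx1 : κ * (1 / (n : ℝ)) ≤ 1 := by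
        rw [mul_one_div]; exact (div_le_one hn0).mpr (hκ1.trans hn1)
      have he1 : Real.exp (κ * (1 / n)) ≤ 3 :=
        (Real.exp_le_exp.mpr hx1).trans (by have := Real.exp_one_lt_d9; norm_num at this ⊢; linarith)
      calc (n : ℝ) ^ 2 * (Real.exp (κ * (1 / n)) - 1) ≤ (n : ℝ) ^ 2 * ((κ * (1 / n)) * Real.exp (κ * (1 / n))) :=
            mul_le_mul_of_nonneg_left (exp_sub_one_le_mul_exp _) (sq_nonneg _)
        _ = n * κ * Real.exp (κ * (1 / n)) := by field_simp
        _ ≤ n * κ * 3 := mul_le_mul_of_nonneg_left he1 (by positivity)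
        _ = 3 * n * κ := by ring
    have hJ : Jlap d n κ t ≤ (63 / 2) * (d * n * κ * t) := by
      unfold Jlap
      rw [← hδdef]
      calc (d : ℝ) * (2 * (n : ℝ) ^ 2 * (Real.exp (|κ| * (1 / n)) - 1) * (δ * (1 + δ)))
          = 2 * d * (((n : ℝ) ^ 2 * (Real.exp (|κ| * (1 / n)) - 1)) * (δ * (1 + δ))) := by ring
        _ ≤ 2 * d * ((3 * n * κ) * ((3 * t) * (7 / 4))) := by
            refine mul_le_mul_of_nonneg_left (mul_le_mul hexp1 (mul_le_mul hδ3 (by linarith) (by linarith) (by positivity)) (by positivity)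
              (by positivity)) (by positivity)
        _ = (63 / 2) * (d * n * κ * t) := by ring
    -- `√d·n·t ≤ √γ/24` and `√d·κ ≤ √γ/40`
    have hA : Real.sqrt d * n * t ≤ Real.sqrt γ / 24 := by
      have hden : 0 < 24 * Real.sqrt d * n + 1 := by positivity
      have h := (le_div_iff₀ hden).mp ht2
      have e : t * (24 * Real.sqrt d * n + 1) = 24 * (Real.sqrt d * n * t) + t := by ring
      linarith
    have hBk : Real.sqrt d * κ ≤ Real.sqrt γ / 40 := by
      have hden : 0 < 40 * Real.sqrt d + 1 := by positivity
      have h := (le_div_iff₀ hden).mp hκd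
      have e : κ * (40 * Real.sqrt d + 1) = 40 * (Real.sqrt d * κ) + κ := by ring
      linarith
    have hprod : (d : ℝ) * n * κ * t ≤ γ / 960 := by
      have hsd : Real.sqrt d * Real.sqrt d = d := Real.mul_self_sqrt hd0
      have hsg : Real.sqrt γ * Real.sqrt γ = γ := Real.mul_self_sqrt hγ.le
      have h := mul_le_mul hA hBk (by positivity) (by positivity)
      calc (d : ℝ) * n * κ * t = (Real.sqrt d * n * t) * (Real.sqrt d * κ) := by linear_combination (-((n : ℝ) * κ * t)) * hsd
        _ ≤ Real.sqrt γ / 24 * (Real.sqrt γ / 40) := h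
        _ = γ / 960 := by linear_combination (1 / 960 : ℝ) * hsg
    linarith
  -- (3) the averaging perturbation: `Javg ≤ (γ/8)·P·κ ≤ γ/24`, `P = Le^L(2 + Le^L)`
  have h3 : Javg co ℓ a' κ L t ≤ γ / 24 := by
    set P := L * Real.exp L * (2 + L * Real.exp L) with hPdef
    have hLe : 0 ≤ L * Real.exp L := by positivity
    have hP0 : 0 ≤ P := by positivity
    -- θ ≤ κ·L·e^L and θ ≤ L e^L
    have hθ0 : 0 ≤ Real.exp (|κ| * L) - 1 := by rw [habs]; linarith [Real.one_le_exp (mul_nonneg hκ0 hL0)]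
    have hθ1 : Real.exp (|κ| * L) - 1 ≤ κ * (L * Real.exp L) := by
      rw [habs]
      have hkL : κ * L ≤ L := mul_le_of_le_one_left hL0 hκ1
      calc Real.exp (κ * L) - 1 ≤ (κ * L) * Real.exp (κ * L) := exp_sub_one_le_mul_exp _
        _ ≤ (κ * L) * Real.exp L := mul_le_mul_of_nonneg_left (Real.exp_le_exp.mpr hkL) (mul_nonneg hκ0 hL0)
        _ = κ * (L * Real.exp L) := by ring
    have hθ2 : Real.exp (|κ| * L) - 1 ≤ L * Real.exp L := hθ1.trans (mul_le_of_le_one_left hLe hκ1)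
    -- `ℓδ ≤ 1`, `E ≤ 2ℓδ ≤ 6ℓt`, `E ≤ 2`
    have hℓδ : (ℓ : ℝ) * δ ≤ 1 := by
      have h1 : (ℓ : ℝ) * δ ≤ ℓ * (3 * t) := mul_le_mul_of_nonneg_left hδ3 hℓ
      have h2 : (3 * (ℓ : ℝ) + 1) * t ≤ 1 := by rwa [le_div_iff₀ (by positivity), mul_comm] at ht1
      linarith
    have hE : Etr δ ℓ ≤ 2 * (ℓ * δ) := by
      have hpow : (1 + δ) ^ ℓ ≤ Real.exp (ℓ * δ) := by
        rw [Real.exp_nat_mul]; exact pow_le_pow_left₀ (by linarith) (by linarith [Real.add_one_le_exp δ]) ℓ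
      have habs' : |Real.exp (ℓ * δ) - 1| ≤ 2 * |(ℓ : ℝ) * δ| := Real.abs_exp_sub_one_le (by rw [abs_of_nonneg (by positivity)]; exact hℓδ)
      rw [abs_of_nonneg (by positivity : (0 : ℝ) ≤ ℓ * δ)] at habs'
      have := (le_abs_self _).trans habs'
      show (1 + δ) ^ ℓ - 1 ≤ 2 * (ℓ * δ)
      linarith
    have hE0 : 0 ≤ Etr δ ℓ := Etr_nonneg hδ0 ℓ
    have hE6 : Etr δ ℓ ≤ 6 * (ℓ * t) := by
      have := mul_le_mul_of_nonneg_left hδ3 hℓ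
      linarith
    have hE2 : Etr δ ℓ ≤ 2 := by linarith
    have hmass : 384 * (a' * (co : ℝ) ^ 2 * (ℓ * t)) ≤ γ := by
      have hden : 0 < 384 * a' * (co : ℝ) ^ 2 * ℓ + 1 := by positivity
      have h := (le_div_iff₀ hden).mp ht3
      have e : t * (384 * a' * (co : ℝ) ^ 2 * ℓ + 1) = 384 * (a' * (co : ℝ) ^ 2 * (ℓ * t)) + t := by ring
      linarith
    have hJ : Javg co ℓ a' κ L t ≤ 48 * (a' * (co : ℝ) ^ 2 * (ℓ * t)) * (P * κ) := by
      unfold Javg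
      rw [← hδdef]
      calc a' * ((co : ℝ) ^ 2 * (Real.exp (|κ| * L) - 1) * Etr δ ℓ * (2 + (Real.exp (|κ| * L) - 1)) * (6 + Etr δ ℓ))
          = a' * (co : ℝ) ^ 2 * ((Real.exp (|κ| * L) - 1) * Etr δ ℓ * ((2 + (Real.exp (|κ| * L) - 1)) * (6 + Etr δ ℓ))) := by ring
        _ ≤ a' * (co : ℝ) ^ 2 * ((κ * (L * Real.exp L)) * (6 * (ℓ * t)) * ((2 + L * Real.exp L) * 8)) := by
            refine mul_le_mul_of_nonneg_left ?_ (by positivity)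
            refine mul_le_mul (mul_le_mul hθ1 hE6 hE0 (by positivity)) (mul_le_mul (by linarith) (by linarith) (by linarith) (by linarith))
              (by positivity) (by positivity)
        _ = 48 * (a' * (co : ℝ) ^ 2 * (ℓ * t)) * (P * κ) := by rw [hPdef]; ring
    have hPκ : P * κ ≤ 1 / 3 := by
      have hden : 0 < 3 * P + 1 := by positivity
      calc P * κ ≤ P * (1 / (3 * P + 1)) := mul_le_mul_of_nonneg_left hκP hP0
        _ = 1 / 3 * (3 * P / (3 * P + 1)) := by field_simp
        _ ≤ 1 / 3 * 1 := mul_le_mul_of_nonneg_left ((div_le_one hden).mpr (by linarith)) (by norm_num)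
        _ = 1 / 3 := mul_one _
    calc Javg co ℓ a' κ L t ≤ 48 * (a' * (co : ℝ) ^ 2 * (ℓ * t)) * (P * κ) := hJ
      _ ≤ 48 * (γ / 384) * (1 / 3) := mul_le_mul (by linarith) hPκ (by positivity) (by positivity)
      _ = γ / 24 := by ring
  show Jch co d n ℓ a' κ (2 * ((d : ℝ) + 1)) t ≤ γ / 8
  rw [Jch, show (2 * ((d : ℝ) + 1)) = L from rfl]
  linarith

variable (n : ℕ) [NeZero n] (M : Fin d → ℕ) [hM : ∀ μ, NeZero (M μ)]
variable {R₀ : Fin d → (Tor (fine n M) × Fin d → Matrix o o ℂ)} {Γ : ContourSystem d n M} {ℓ : ℕ} {a' γ : ℝ}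

/-- **ENTRY DECAY AT THE EXPLICIT RATE**: for unitary `R⁰` with `γ`-coercive real slice, `a′ ≥ 0`, contours of length `≤ ℓ`, `2 ≤ n·M_μ` and
`‖A‖ < rho1 n d a′ |o| ℓ γ`: `‖G(e^{A}R⁰, (R⁰)⁻¹e^{−A})(i, i′)‖ ≤ (8/γ)·e^{−κ_F·dist_∞(x,x′)/n}`, `κ_F = kappaF |o| d a′ γ` LEVEL-FREE. [folklore] -/
theorem greenT_chart_entry_decay_explicit (hR₀ : ∀ ν i, R₀ ν i ∈ Matrix.unitaryGroup o ℂ) (hΓ : ∀ y j μ (t : Fin n), (Γ y j μ t).length ≤ ℓ)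
    (ha' : 0 ≤ a') (hco : Coercive γ (vecOp n M a' Γ R₀)) (hγ : 0 < γ) (h2 : ∀ μ, 2 ≤ fine n M μ)
    {A : Fin d → (Tor (fine n M) × Fin d → Matrix o o ℂ)} (hA : ‖A‖ < rho1 n d a' (Fintype.card o) ℓ γ) (i i' : (Tor (fine n M) × Fin d) × o) :
    ‖greenT n M ((n : ℕ) : ℂ) (a' * (n : ℝ) ^ d) Γ (expChart R₀ A) (expChartInv R₀ A) i i'‖
      ≤ 8 / γ * Real.exp (-(kappaF (Fintype.card o) d a' γ * (ldist (fine n M) i.1.1 i'.1.1 / n))) := by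
  have hn1 : 1 ≤ n := Nat.one_le_iff_ne_zero.mpr (NeZero.ne n)
  have hk := kappaF_pos_le_one (Fintype.card o) d ha' hγ
  have hJ := Jch_kappaF_le ha' hγ (Fintype.card_pos (α := o)) hn1 d ℓ (norm_nonneg A) hA
  have hJ' : JchT (Fintype.card o) d n ℓ a' (kappaF (Fintype.card o) d a' γ) ‖A‖ < γ / 4 := by linarith
  refine (greenT_chart_entry_decay n M hR₀ hΓ ha' hco hγ h2 hA hk.1.le hJ' i i').trans ?_
  have hle : (γ / 4 - JchT (Fintype.card o) d n ℓ a' (kappaF (Fintype.card o) d a' γ) ‖A‖)⁻¹ ≤ 8 / γ := by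
    rw [show (8 : ℝ) / γ = (γ / 8)⁻¹ by rw [inv_div]]
    exact inv_anti₀ (by positivity) (by linarith)
  rw [div_eq_mul_inv, mul_comm]
  exact mul_le_mul_of_nonneg_right hle (Real.exp_pos _).le

end Rate

/-! ## §5 The tower corollary on the scaling-form ball -/

section Tower

open Literature.MathematicalPhysics.QuantumFieldTheory.Balaban1983to89 (Params)
open Summit.QuantumFields.BalabanUV.T4Continuum.SubstrateBackgroundTransporters (unitMod)
open Literature.MathematicalPhysics.QuantumFieldTheory.Balaban1983to89.B5G183RateUnitTower (lev lev_neZero)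
open Summit.QuantumFields.BalabanUV.T4Continuum.SubstrateTransporterSpeciesHolo (expChartT expChartInvT)

/-- **ENTRY DECAY ON THE TOWER BALL OF RECORD**: at NE2 level `k` (letters `c = lev k`, `a = a′·(lev k)^d`), for a unitary reference field with
`γ`-coercive real slice, contours of length `≤ ℓ ≤ (d+1)·lev k` and `2 ≤ lev k·(unit torus)`: every chart point of the scaling-form ball
`InHoloBallT P R⁰ (rhoStar γ d a′ |o| / lev k)` has a Green's function decaying at the level-free rate `κ_F/lev k` with amplitude `8/γ` —
the substrate's PROVED form of the operator bounds NE5 ∕ NE4 ∕ NE9 read at complex chart points. [folklore] -/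
theorem greenT_chart_entry_decay_tower (P : Params) (Γ : (k : ℕ) → ContourSystem P.d (lev P.L k) (unitMod P)) {R₀ : TowerData P o}
    (k : Fin (P.K + 1)) {ℓ : ℕ} (hΓ : ∀ y j μ (t : Fin (lev P.L k)), (Γ k y j μ t).length ≤ ℓ) (hℓ : (ℓ : ℝ) ≤ ((P.d : ℝ) + 1) * (lev P.L k : ℕ))
    (hR₀ : ∀ ν i, R₀ k ν i ∈ Matrix.unitaryGroup o ℂ) {a' γ : ℝ} (ha' : 0 ≤ a') (hco : Coercive γ (vecOp (lev P.L k) (unitMod P) a' (Γ k) (R₀ k)))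
    (hγ : 0 < γ) (h2 : ∀ μ, 2 ≤ fine (lev P.L k) (unitMod P) μ) {A : TowerData P o}
    (hA : InHoloBallT P R₀ (rhoStar γ P.d a' (Fintype.card o) / (lev P.L k : ℕ)) A) (i i' : (Tor (fine (lev P.L k) (unitMod P)) × Fin P.d) × o) :
    ‖greenT (lev P.L k) (unitMod P) (((lev P.L k : ℕ) : ℂ)) (a' * ((lev P.L k : ℕ) : ℝ) ^ P.d) (Γ k) (expChartT P R₀ A k) (expChartInvT P R₀ A k) i i'‖
      ≤ 8 / γ * Real.exp (-(kappaF (Fintype.card o) P.d a' γ * (ldist (fine (lev P.L k) (unitMod P)) i.1.1 i'.1.1 / (lev P.L k : ℕ)))) := by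
  have hn : 1 ≤ (lev P.L k : ℕ) := Nat.one_le_iff_ne_zero.mpr (NeZero.ne _)
  have hAk : ‖A k‖ < rho1 (lev P.L k) P.d a' (Fintype.card o) ℓ γ :=
    lt_of_lt_of_le (inHoloBallT_apply P hA k) (rhoStar_div_le_rho1 (lev P.L k) (d := P.d) ha' hγ (Fintype.card o) hn hℓ)
  exact greenT_chart_entry_decay_explicit (lev P.L k) (unitMod P) hR₀ hΓ ha' hco hγ h2 hAk i i'

end Tower

end Summit.QuantumFields.BalabanUV.T4Continuum.CovariantVectorGreenDecayChartExplicit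

end
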